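/-
Copyright (c) 2026 the pub-hodgecm-mathlib formalisation cell (harness21).  Prover seat hodgecm-mathlib-R90-C131-p02 (g0) (R90-TF S4 hand lent to L1
by CHAIR VALVE WORD W4), Track B «K2-LIT», hLiu418 = `stmt-HodgeConjecture-24832`; K1-a♮ line lead K2E5-p16 (g8) WORD #9 (1)(iii) ∕ WORD #11 (α)
«owner of the arch letters `(A, Ac, hA, hAc)` of ★ p863286 §2».  THEOREMS ONLY (no `def`, no instance, no notation, no named-fact hypothesis, no `sorry`);
lane `--supports stmt-HodgeConjecture-24832 --as helper`.
-/
import Summits.HodgeConjecture.HodgeConjecture.Theorems.K2LiuArchTwistedScalarBlockContinuationNeg   -- ★ (3c-cont⁻) `T ≤ 0`; brings ★ p863260 (3c-cont) `T ≥ 0`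
import HarnessLib

/-!
# Crux `HLiu418`, KIND 1 a♮, the ARCHIMEDEAN PLACE LETTERS `(A, Ac, hA, hAc)` of ★ `K2LiuKindOneSingularGlobalAssembler` §2 for the scalar `K_w`-type:
# ONE continuation `Ac s h` of the twisted big-cell block, jointly in the point `h ∈ U(J)`, holomorphic on `{0 < re s}`, for either sign of the index

Cell `hodgecm-mathlib`, crux item hLiu418 = `stmt-HodgeConjecture-24832` (helper lane, count-neutral).  ★ `exists_headContinuation_of_placeLetters(_sum)`
(LH4-p07, ★ p863286) takes, per pure tensor, arch letters `(A Ac : ℂ → H → ℂ)` with `hAc : ∀ h, DifferentiableOn ℂ (fun s => Ac s h) {s | 0 < s.re}`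
and `hA : ∀ s, 1 < s.re → ∀ h, A s h = Ac s h`.  For the SCALAR `K_w`-type arch component the raw letter at a point `h ∈ U(J)` and a rank-one
real-place index `T = ±a·diag(t,0)·aᴴ` is the twisted big-cell block `A s h = ∫ e(−τ(T·X)) f⁰_{s,k}(J n(X) h) dX`; ★ p863260 ∕ ★ (3c-cont⁻) give,
point by point, `∃ E` holomorphic on `{0 < re s}` agreeing with it on `{½ < re s}`.  THIS FILE packages them into ONE function of `(s, h)` (choice over
the point), i.e. the letters in the assembler's shape over the point type `U(J)` (a consumer with a point type `H → U(J)` composes):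
* §1 **`exists_archLetters_scalarType`** (`T = a·diag(t,0)·aᴴ ≥ 0`, `k/2 < N`) and **`exists_archLetters_scalarType_neg`** (`T = −a·diag(t,0)·aᴴ ≤ 0`,
  `−k/2 < N`): `∃ Ac : ℂ → M₄(ℂ) → ℂ, (∀ h ∈ U(J), DifferentiableOn ℂ (fun s => Ac s h) {0 < re}) ∧ (∀ s, ½ < re s → ∀ h ∈ U(J), A s h = Ac s h)`.
* §2 (ED. 2) the CORNER index `Matrix.single 1 1 σ` of ★ (K1a-T) `exists_cornerData_of_record` (K2Liu-p03): `single 1 1 σ = swap·hermTwo(σ,0,0)·swapᴴ`,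
  `‖det swap‖ = 1`; **`exists_archLetters_scalarType_corner`** (`σ > 0`) ∕ **`_corner_neg`** (`σ < 0`).
The non-scalar `K_w`-types (ray derivatives of the scalar block in the point: ★ `K2LiuArchTwistedIntertwiningKFiniteSwap` + ★ `…ScalarBlockExplicit` +
★ `…ScalarBlockParamSmooth` (d)) are the sequel of this file.

HONEST LABEL: scalar `K_w`-type only; closes no socket.  HC_CM is proved only modulo the 7 printed citations (2 remaining named inputs: hLiu418 =
`stmt-HodgeConjecture-24832`, h413 = `stmt-HodgeConjecture-24833`) until rung 0 closes.  REL ≠ ★ ≠ BUILT.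

## References
* [Shimura1982] G. Shimura, *Confluent hypergeometric functions on tube domains*, Math. Ann. 260 (1982), §3 Thm. 3.1, §4 Thm. 4.2.
* [Shimura1997] G. Shimura, *Euler Products and Eisenstein Series*, CBMS 93 (1997), §16.4, §18.4–18.5.
* [Tan1999] V. Tan, *Poles of Siegel Eisenstein series on U(n,n)*, Canad. J. Math. 51 (1999), §3.
-/

set_option autoImplicit false
set_option linter.dupNamespace false

noncomputable section

open Complex MeasureTheory Set Matrix
open scoped ComplexOrder ComplexConjugate

namespace Summit.HodgeConjecture.HodgeConjecture.Cruxes.HLiu418.K2LiuArchTwistedKTypeBlockContinuation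

open Summit.HodgeConjecture.HodgeConjecture.Cruxes.HLiu418.K2LiuHermTwoGammaDefs
open Summit.HodgeConjecture.HodgeConjecture.Cruxes.HLiu418.K2LiuHermTwoEtaDefs
open Summit.HodgeConjecture.HodgeConjecture.Cruxes.HLiu418.K2LiuArchInducedTubeDefs
open Summit.HodgeConjecture.HodgeConjecture.Cruxes.HLiu418.K2LiuArchTwistedScalarBlockContinuation
open Summit.HodgeConjecture.HodgeConjecture.Cruxes.HLiu418.K2LiuArchTwistedScalarBlockContinuationNeg
open Summit.HodgeConjecture.HodgeConjecture.Cruxes.HLiu418.K2LiuHermTwoXiEtaSymmetry (hermTwo_neg)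

/-! ## §1 The scalar-type arch letters, jointly in the point -/

/-- **THE ARCH LETTERS OF THE SCALAR `K_w`-TYPE, NON-NEGATIVE RANK-ONE INDEX** (`T = a·diag(t,0)·aᴴ`, `‖det a‖ = 1`, `t > 0`, `k/2 < N`): ONE function
`Ac s h`, holomorphic in `s` on `{0 < re s}` at every `h ∈ U(J)`, with `∫ e(−τ(T·X)) f⁰_{s,k}(J n(X) h) dX = Ac s h` for `½ < re s`, `h ∈ U(J)`
(★ p863260 point by point, packaged by choice over the point). [Shimura1982, §4 Thm. 4.2] [Tan1999, §3] -/
theorem exists_archLetters_scalarType (k : ℤ) {a : Matrix (Fin 2) (Fin 2) ℂ} (hdet : ‖a.det‖ = 1) {t : ℝ} (ht : 0 < t) {N : ℕ} (hN : (k : ℝ) / 2 < N) :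
    ∃ Ac : ℂ → Matrix (Fin 2 ⊕ Fin 2) (Fin 2 ⊕ Fin 2) ℂ → ℂ,
      (∀ h : Matrix (Fin 2 ⊕ Fin 2) (Fin 2 ⊕ Fin 2) ℂ, hᴴ * Matrix.J (Fin 2) ℂ * h = Matrix.J (Fin 2) ℂ →
        DifferentiableOn ℂ (fun s => Ac s h) {s : ℂ | 0 < s.re}) ∧
      (∀ s : ℂ, 1 / 2 < s.re → ∀ h : Matrix (Fin 2 ⊕ Fin 2) (Fin 2 ⊕ Fin 2) ℂ, hᴴ * Matrix.J (Fin 2) ℂ * h = Matrix.J (Fin 2) ℂ →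
        (∫ r : Fin 2 → Fin 2 → ℝ, cexp (-(2 * Real.pi * I) * ((a * hermTwo (t, 0, 0) * aᴴ) * hermOfReal r).trace) *
          archScalarSection k s (Matrix.J (Fin 2) ℂ * fromBlocks 1 (hermOfReal r) 0 1 * h)) = Ac s h) := by
  classical
  choose! E hEd hEeq using fun (h : Matrix (Fin 2 ⊕ Fin 2) (Fin 2 ⊕ Fin 2) ℂ) (hh : hᴴ * Matrix.J (Fin 2) ℂ * h = Matrix.J (Fin 2) ℂ) =>
    twistedArchBlock_scalarType_continuation k hh hdet ht hN
  exact ⟨fun s h => E h s, fun h hh => hEd h hh, fun s hs h hh => hEeq h hh s hs⟩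

/-- **THE ARCH LETTERS OF THE SCALAR `K_w`-TYPE, NON-POSITIVE RANK-ONE INDEX** (`T = −a·diag(t,0)·aᴴ`, `‖det a‖ = 1`, `t > 0`, `−k/2 < N`): as above
over ★ (3c-cont⁻) `twistedArchBlock_scalarType_continuation_neg`. [Shimura1982, (1.28), §4 Thm. 4.2] [Tan1999, §3] -/
theorem exists_archLetters_scalarType_neg (k : ℤ) {a : Matrix (Fin 2) (Fin 2) ℂ} (hdet : ‖a.det‖ = 1) {t : ℝ} (ht : 0 < t) {N : ℕ}
    (hN : -(k : ℝ) / 2 < N) :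
    ∃ Ac : ℂ → Matrix (Fin 2 ⊕ Fin 2) (Fin 2 ⊕ Fin 2) ℂ → ℂ,
      (∀ h : Matrix (Fin 2 ⊕ Fin 2) (Fin 2 ⊕ Fin 2) ℂ, hᴴ * Matrix.J (Fin 2) ℂ * h = Matrix.J (Fin 2) ℂ →
        DifferentiableOn ℂ (fun s => Ac s h) {s : ℂ | 0 < s.re}) ∧
      (∀ s : ℂ, 1 / 2 < s.re → ∀ h : Matrix (Fin 2 ⊕ Fin 2) (Fin 2 ⊕ Fin 2) ℂ, hᴴ * Matrix.J (Fin 2) ℂ * h = Matrix.J (Fin 2) ℂ →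
        (∫ r : Fin 2 → Fin 2 → ℝ, cexp (-(2 * Real.pi * I) * ((-(a * hermTwo (t, 0, 0) * aᴴ)) * hermOfReal r).trace) *
          archScalarSection k s (Matrix.J (Fin 2) ℂ * fromBlocks 1 (hermOfReal r) 0 1 * h)) = Ac s h) := by
  classical
  choose! E hEd hEeq using fun (h : Matrix (Fin 2 ⊕ Fin 2) (Fin 2 ⊕ Fin 2) ℂ) (hh : hᴴ * Matrix.J (Fin 2) ℂ * h = Matrix.J (Fin 2) ℂ) =>
    twistedArchBlock_scalarType_continuation_neg k hh hdet ht hN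
  exact ⟨fun s h => E h s, fun h hh => hEd h hh, fun s hs h hh => hEeq h hh s hs⟩

/-! ## §2 (ED. 2) The corner index `single 1 1 σ` of ★ (K1a-T) `exists_cornerData_of_record` -/

/-- `‖det [[0,1],[1,0]]‖ = 1`. [folklore] -/
theorem norm_det_swapTwo : ‖(!![0, 1; 1, 0] : Matrix (Fin 2) (Fin 2) ℂ).det‖ = 1 := by
  rw [Matrix.det_fin_two_of]
  simp

/-- The corner index is a unimodular rotation of `diag(σ, 0)`: `single 1 1 σ = [[0,1],[1,0]] · hermTwo (σ, 0, 0) · [[0,1],[1,0]]ᴴ` (`σ` real). [folklore] -/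
theorem single_one_one_eq_swap_conj (σ : ℝ) :
    (Matrix.single 1 1 ((σ : ℝ) : ℂ) : Matrix (Fin 2) (Fin 2) ℂ) =
      (!![0, 1; 1, 0] : Matrix (Fin 2) (Fin 2) ℂ) * hermTwo (σ, 0, 0) * (!![0, 1; 1, 0] : Matrix (Fin 2) (Fin 2) ℂ)ᴴ := by
  ext i j
  fin_cases i <;> fin_cases j <;>
    simp [hermTwo, Matrix.mul_apply, Fin.sum_univ_two, Matrix.conjTranspose_apply]

/-- The negative corner index: `single 1 1 σ = −([[0,1],[1,0]] · hermTwo (−σ, 0, 0) · [[0,1],[1,0]]ᴴ)` (`σ` real). [folklore] -/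
theorem single_one_one_eq_neg_swap_conj (σ : ℝ) :
    (Matrix.single 1 1 ((σ : ℝ) : ℂ) : Matrix (Fin 2) (Fin 2) ℂ) =
      -((!![0, 1; 1, 0] : Matrix (Fin 2) (Fin 2) ℂ) * hermTwo (-σ, 0, 0) * (!![0, 1; 1, 0] : Matrix (Fin 2) (Fin 2) ℂ)ᴴ) := by
  have h : hermTwo (-σ, 0, 0) = -hermTwo (σ, 0, 0) := by
    rw [← hermTwo_neg]
    simp
  rw [h, Matrix.mul_neg, Matrix.neg_mul, neg_neg]
  exact single_one_one_eq_swap_conj σ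

/-- **THE SCALAR-TYPE ARCH LETTERS AT A POSITIVE CORNER INDEX `single 1 1 σ`, `σ > 0`** (`k/2 < N`): the shape of ★ (K1a-T)'s corner presentation
`W_S(f)(h) = W_{single 1 1 (σc S)}(f)(gc S · h)` at a real place with `σ > 0`. [Shimura1982, §4 Thm. 4.2] [Tan1999, §3] -/
theorem exists_archLetters_scalarType_corner (k : ℤ) {σ : ℝ} (hσ : 0 < σ) {N : ℕ} (hN : (k : ℝ) / 2 < N) :
    ∃ Ac : ℂ → Matrix (Fin 2 ⊕ Fin 2) (Fin 2 ⊕ Fin 2) ℂ → ℂ,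
      (∀ h : Matrix (Fin 2 ⊕ Fin 2) (Fin 2 ⊕ Fin 2) ℂ, hᴴ * Matrix.J (Fin 2) ℂ * h = Matrix.J (Fin 2) ℂ →
        DifferentiableOn ℂ (fun s => Ac s h) {s : ℂ | 0 < s.re}) ∧
      (∀ s : ℂ, 1 / 2 < s.re → ∀ h : Matrix (Fin 2 ⊕ Fin 2) (Fin 2 ⊕ Fin 2) ℂ, hᴴ * Matrix.J (Fin 2) ℂ * h = Matrix.J (Fin 2) ℂ →
        (∫ r : Fin 2 → Fin 2 → ℝ, cexp (-(2 * Real.pi * I) * ((Matrix.single 1 1 ((σ : ℝ) : ℂ) : Matrix (Fin 2) (Fin 2) ℂ) * hermOfReal r).trace) *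
          archScalarSection k s (Matrix.J (Fin 2) ℂ * fromBlocks 1 (hermOfReal r) 0 1 * h)) = Ac s h) := by
  rw [single_one_one_eq_swap_conj σ]
  exact exists_archLetters_scalarType k norm_det_swapTwo hσ hN

/-- **THE SCALAR-TYPE ARCH LETTERS AT A NEGATIVE CORNER INDEX `single 1 1 σ`, `σ < 0`** (`−k/2 < N`). [Shimura1982, (1.28), §4 Thm. 4.2] [Tan1999, §3] -/
theorem exists_archLetters_scalarType_corner_neg (k : ℤ) {σ : ℝ} (hσ : σ < 0) {N : ℕ} (hN : -(k : ℝ) / 2 < N) :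
    ∃ Ac : ℂ → Matrix (Fin 2 ⊕ Fin 2) (Fin 2 ⊕ Fin 2) ℂ → ℂ,
      (∀ h : Matrix (Fin 2 ⊕ Fin 2) (Fin 2 ⊕ Fin 2) ℂ, hᴴ * Matrix.J (Fin 2) ℂ * h = Matrix.J (Fin 2) ℂ →
        DifferentiableOn ℂ (fun s => Ac s h) {s : ℂ | 0 < s.re}) ∧
      (∀ s : ℂ, 1 / 2 < s.re → ∀ h : Matrix (Fin 2 ⊕ Fin 2) (Fin 2 ⊕ Fin 2) ℂ, hᴴ * Matrix.J (Fin 2) ℂ * h = Matrix.J (Fin 2) ℂ →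
        (∫ r : Fin 2 → Fin 2 → ℝ, cexp (-(2 * Real.pi * I) * ((Matrix.single 1 1 ((σ : ℝ) : ℂ) : Matrix (Fin 2) (Fin 2) ℂ) * hermOfReal r).trace) *
          archScalarSection k s (Matrix.J (Fin 2) ℂ * fromBlocks 1 (hermOfReal r) 0 1 * h)) = Ac s h) := by
  rw [single_one_one_eq_neg_swap_conj σ]
  exact exists_archLetters_scalarType_neg k norm_det_swapTwo (neg_pos.mpr hσ) hN

end Summit.HodgeConjecture.HodgeConjecture.Cruxes.HLiu418.K2LiuArchTwistedKTypeBlockContinuation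

end
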